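import Literature.AnabelianGeometry.AbsoluteAnabelian.AbsTopII.TwoTripodNodalLogPoints
import Literature.AnabelianGeometry.SemiGraphs.ProSigmaCompletionInjective
import HarnessLib

/-!
# [AbsTopII] Prop 1.3 (x) at the two-vertex nodal datum, II: a slope section lies in no foreign decomposition group

S. Mochizuki, *Topics in Absolute Anabelian Geometry II* [AbsTopII] (bib `MochizukiAbsTopII2013`; locators =
PDF pages of the kurims manuscript `paper:url-585b8d0ad0d9`), §1 Prop 1.3 (viii) p. 12 (the edge-pair calculus) and
Prop 1.3 (x) p. 12 ("the image of `τ_S` is the unique cusp `e_τ` of `X` such that [for an appropriate choice of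
conjugate of `D_{e_τ}`] `τ_I(I) ⊆ D_{e_τ}`").

PROOF-ONLY companion (abc-iut-f-066 gen 7, row «P13x″-TWO-VERTEX») of `AbsTopII/TwoTripodNodalLogPoints.lean`, the
ENGINE behind the uniqueness clause of Prop 1.3 (x) at the degenerating 4-pointed sphere `M.dpsc` (two tripods, one
non-loop node, cusps `c₁, c₂ | c₃, c₀`, every `Σ`):

* `cuspD_inf_conj_nodeD_le_baseSec`, `cuspD_inf_conj_cuspD_le_baseSec` — abc-iut-f-066 gen 6's twenty-pair table
  (`TwoTripodNodalEdgePairs.lean`) read inside `P`: `(Π_{c_j}·I_v) ∩ γ D_ε γ⁻¹ ⊆ I_v` for every edge `ε ≠ c_j` and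
  `γ ∈ Π_𝔾` (`I_v ∩ Z(γ)` at a common vertex, `1` otherwise);
* `c_pow_ne_one`, `inl_pow_ne_one` — `c_j^n ≠ 1` (`n ≥ 1`) in `Γ_{0,4}` and in `P` (injectivity of the pro-`Σ`
  completion on the free group, abc-iut-L3 lineage `injective_of_isFreeGroup`), whence
  `not_cuspSection_le_baseSec`: **a slope section of positive slope is not contained in `I_v`**;
* ★ `not_conj_cuspSection_le_conj` — **ENGINE: if `(Π_{c_j}·I_v) ∩ γDγ⁻¹ ⊆ I_v` for all `γ ∈ Π_𝔾`, then no
  `P`-conjugate of `S_{j,n}` (`n ≥ 1`) lies in a `Π_𝔾`-conjugate of `D`** (write `δ = γ₁ s` with `s ∈ I_v`; a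
  containment gives `s S_{j,n} s⁻¹ ⊆ I_v`); instances `not_conj_cuspSection_le_conj_nodeD` (`D = D_e = Π_e·T`) and
  `not_conj_cuspSection_le_conj_cuspD` (`D = D_{c_{j'}}`, `j' ≠ j`);
* `exists_conj_le_conj_nodeD` — a `P`-conjugate of a subgroup of `D_e` lies in a `Π_𝔾`-conjugate of `D_e`
  (`P = Π_𝔾·T`, `T ⊆ D_e`); `PiG_ne_top`.
Statements are written inside `P` (`Π_H = P` definitionally; `D_{c_j} = Π_{c_j}·I_v`, `D_e = Π_e·T` by gen 5/6), so that
the typed clauses of `TwoTripodNodalProp13x.lean` consume them by definitional unfolding.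
HONEST FRAMING: classical profinite group theory at a constructed model (constructed ≠ geometric); nothing here bears on
[IUTchIII] Cor 3.12; no side taken.
-/

noncomputable section

open scoped Pointwise

namespace Literature.AnabelianGeometry.AbsoluteAnabelian.AbsTopII.TwoTripodNodal.Model

open Literature.AnabelianGeometry.SemiGraphs
open Literature.AnabelianGeometry.SemiGraphs.SemiGraphOfAnabelioids (IsProSigmaCompletion)
open Literature.AnabelianGeometry.SemiGraphs.SemiGraphOfAnabelioids.IsProSigmaCompletion
open Literature.AnabelianGeometry.Anabelioids (IsSigmaInteger)
open Literature.GroupTheory.CombinatorialGroupTheory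
open Literature.GroupTheory.CombinatorialGroupTheory.PuncturedSurfaceGroup
open Literature.GroupTheory.CombinatorialGroupTheory.FreeFactorFibredTwist (lift_apply_basis)
open _root_.Topology

variable {Sigma : Set ℕ} (M : Model Sigma)

/-! ### `D_{c_j} ∩ γ D_ε γ⁻¹ ⊆ I_v` for every edge `ε ≠ c_j` (inside `P`) -/

/-- **Node case of the edge-pair bound**: `(Π_{c_j}·I_v) ∩ γ (Π_e·T) γ⁻¹ ⊆ I_v` for `γ ∈ Π_𝔾` (`D_{c_j} = Π_{c_j}·I_v`,
`D_e = Π_e·T`; the twenty-pair table of `TwoTripodNodalEdgePairs.lean` gives `I_v ∩ Z(γ)`).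
[cite: MochizukiAbsTopII2013, Prop 1.3 (viii) p.12] -/
theorem cuspD_inf_conj_nodeD_le_baseSec (hne : Sigma.Nonempty) (hprime : ∀ p ∈ Sigma, p.Prime) (j : Fin 4) {γ : M.P} (hγ : γ ∈ M.PiG) :
    ((M.cuspGp j).map M.PiG.subtype ⊔ M.baseSec j) ⊓
        MulAut.conj γ • ((M.nodeGp).map M.PiG.subtype ⊔ M.T) ≤ M.baseSec j := by
  have hj : j = 0 ∨ j = 1 ∨ j = 2 ∨ j = 3 := by fin_cases j <;> simp
  rcases hj with rfl | rfl | rfl | rfl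
  · have h := M.Dc0_inf_conj_De hne hprime ⟨()⟩ hγ
    rw [DvCusp_zero_eq, DvNode_eq_WT] at h
    exact h.le.trans inf_le_left
  · have h := M.Dc1_inf_conj_De hne hprime ⟨()⟩ hγ
    rw [DvCusp_one_eq, DvNode_eq_WT] at h
    exact h.le.trans inf_le_left
  · have h := M.Dc2_inf_conj_De hne hprime ⟨()⟩ hγ
    rw [DvCusp_two_eq, DvNode_eq_WT] at h
    exact h.le.trans inf_le_left
  · have h := M.Dc3_inf_conj_De hne hprime ⟨()⟩ hγ
    rw [DvCusp_three_eq, DvNode_eq_WT] at h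
    exact h.le.trans inf_le_left

/-- **Cusp case of the edge-pair bound**: `(Π_{c_j}·I_v) ∩ γ (Π_{c_{j'}}·I_{v'}) γ⁻¹ ⊆ I_v` for `j' ≠ j` and `γ ∈ Π_𝔾`
(`I_v ∩ Z(γ)` at a common vertex, `1` otherwise). [cite: MochizukiAbsTopII2013, Prop 1.3 (viii) p.12] -/
theorem cuspD_inf_conj_cuspD_le_baseSec (hne : Sigma.Nonempty) (hprime : ∀ p ∈ Sigma, p.Prime) (j j' : Fin 4) (hjj' : j' ≠ j) {γ : M.P} (hγ : γ ∈ M.PiG) :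
    ((M.cuspGp j).map M.PiG.subtype ⊔ M.baseSec j) ⊓
        MulAut.conj γ • ((M.cuspGp j').map M.PiG.subtype ⊔ M.baseSec j') ≤ M.baseSec j := by
  have hj : j = 0 ∨ j = 1 ∨ j = 2 ∨ j = 3 := by fin_cases j <;> simp
  have hj' : j' = 0 ∨ j' = 1 ∨ j' = 2 ∨ j' = 3 := by fin_cases j' <;> simp
  rcases hj with rfl | rfl | rfl | rfl <;> rcases hj' with rfl | rfl | rfl | rfl
  · exact absurd rfl hjj'
  · have h := M.Dc0_inf_conj_Dc1_eq_bot hne hprime hγ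
    rw [DvCusp_zero_eq, DvCusp_one_eq] at h
    exact h.le.trans bot_le
  · have h := M.Dc0_inf_conj_Dc2_eq_bot hne hprime hγ
    rw [DvCusp_zero_eq, DvCusp_two_eq] at h
    exact h.le.trans bot_le
  · have h := M.Dc0_inf_conj_Dc3 hne hprime hγ
    rw [DvCusp_zero_eq, DvCusp_three_eq] at h
    exact h.le.trans inf_le_left
  · have h := M.Dc1_inf_conj_Dc0_eq_bot hne hprime hγ
    rw [DvCusp_one_eq, DvCusp_zero_eq] at h
    exact h.le.trans bot_le
  · exact absurd rfl hjj'
  · have h := M.Dc1_inf_conj_Dc2 hne hprime hγ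
    rw [DvCusp_one_eq, DvCusp_two_eq] at h
    exact h.le.trans inf_le_left
  · have h := M.Dc1_inf_conj_Dc3_eq_bot hne hprime hγ
    rw [DvCusp_one_eq, DvCusp_three_eq] at h
    exact h.le.trans bot_le
  · have h := M.Dc2_inf_conj_Dc0_eq_bot hne hprime hγ
    rw [DvCusp_two_eq, DvCusp_zero_eq] at h
    exact h.le.trans bot_le
  · have h := M.Dc2_inf_conj_Dc1 hne hprime hγ
    rw [DvCusp_two_eq, DvCusp_one_eq] at h
    exact h.le.trans inf_le_left
  · exact absurd rfl hjj'
  · have h := M.Dc2_inf_conj_Dc3_eq_bot hne hprime hγ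
    rw [DvCusp_two_eq, DvCusp_three_eq] at h
    exact h.le.trans bot_le
  · have h := M.Dc3_inf_conj_Dc0 hne hprime hγ
    rw [DvCusp_three_eq, DvCusp_zero_eq] at h
    exact h.le.trans inf_le_left
  · have h := M.Dc3_inf_conj_Dc1_eq_bot hne hprime hγ
    rw [DvCusp_three_eq, DvCusp_one_eq] at h
    exact h.le.trans bot_le
  · have h := M.Dc3_inf_conj_Dc2_eq_bot hne hprime hγ
    rw [DvCusp_three_eq, DvCusp_two_eq] at h
    exact h.le.trans bot_le
  · exact absurd rfl hjj'

/-! ### A slope section of slope `n ≥ 1` is not contained in `I_v` -/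

/-- `c_j^n ≠ 1` in `Γ_{0,4}` for `n ≥ 1` (the character `c₁, c₂, c₃ ↦ 1` takes the value `n·f(c_j) ≠ 0` on `c_j^n`).
[cite: MochizukiAbsTopII2013, Ex 1.1 (ii) p.9] -/
theorem c_pow_ne_one (j : Fin 4) {n : ℕ} (hn : 0 < n) : (c j : PuncturedSurfaceGroup 0 4) ^ n ≠ 1 := by
  obtain ⟨b, hb⟩ := exists_freeGroupBasis_succ
  have hb0 : b 0 = c 1 := hb 0
  have hb1 : b 1 = c 2 := hb 1
  have hb2 : b 2 = c 3 := hb 2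
  let f : PuncturedSurfaceGroup 0 4 →* Multiplicative ℤ :=
    b.lift ![Multiplicative.ofAdd 1, Multiplicative.ofAdd 1, Multiplicative.ofAdd 1]
  have hfb : ∀ i, f (b i) = ![Multiplicative.ofAdd (1 : ℤ), Multiplicative.ofAdd 1, Multiplicative.ofAdd 1] i :=
    fun i => lift_apply_basis b _ i
  have hf1 : f (c 1) = Multiplicative.ofAdd 1 := by rw [← hb0, hfb]; rfl
  have hf2 : f (c 2) = Multiplicative.ofAdd 1 := by rw [← hb1, hfb]; rfl
  have hf3 : f (c 3) = Multiplicative.ofAdd 1 := by rw [← hb2, hfb]; rfl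
  have hval : ∃ m : ℤ, m ≠ 0 ∧ f (c j) = Multiplicative.ofAdd m := by
    have hj : j = 0 ∨ j = 1 ∨ j = 2 ∨ j = 3 := by fin_cases j <;> simp
    rcases hj with rfl | rfl | rfl | rfl
    · refine ⟨-3, by norm_num, ?_⟩
      rw [c_zero_eq_inv, map_inv, map_mul, map_mul, hf1, hf2, hf3]; rfl
    · exact ⟨1, one_ne_zero, hf1⟩
    · exact ⟨1, one_ne_zero, hf2⟩
    · exact ⟨1, one_ne_zero, hf3⟩
  obtain ⟨m, hm, hfj⟩ := hval
  intro h
  have h1 : f (c j ^ n) = 1 := by rw [h, map_one]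
  rw [map_pow, hfj, ← ofAdd_nsmul, nsmul_eq_mul, ofAdd_eq_one] at h1
  exact (mul_ne_zero (Nat.cast_ne_zero.mpr hn.ne') hm) h1

/-- `ι(inl c_j^n) ≠ 1` in `P` for `n ≥ 1`: the pro-`Σ` completion `κG : Γ_{0,4} → Π_𝔾` is injective on the free group
`Γ_{0,4}` (`Σ ≠ ∅`). [cite: MochizukiSemiAnbd2006, Ex. 2.10 p.31] -/
theorem inl_pow_ne_one (hne : Sigma.Nonempty) (hprime : ∀ p ∈ Sigma, p.Prime) (j : Fin 4) {n : ℕ} (hn : 0 < n) :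
    M.ι (SemidirectProduct.inl (c j ^ n : PuncturedSurfaceGroup 0 4)) ≠ 1 := by
  obtain ⟨b, -⟩ := exists_freeGroupBasis_succ
  haveI : IsFreeGroup (PuncturedSurfaceGroup 0 4) := b.isFreeGroup
  obtain ⟨p, hp⟩ := hne
  have hinj := injective_of_isFreeGroup M.isProSigmaCompletion_κG ⟨p, hp, hprime p hp⟩
  intro h
  have h1 : M.κG (c j ^ n) = M.κG 1 := Subtype.ext (by rw [coe_κG, h, map_one, Subgroup.coe_one])
  exact c_pow_ne_one j hn (hinj h1)

/-- `ι(inl c_j^n) ∉ I_v` for `n ≥ 1` (`I_v ∩ Π_𝔾 = 1`). [cite: MochizukiAbsTopII2013, Prop 1.3 (iii) p.11] -/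
theorem inl_pow_notMem_baseSec (hne : Sigma.Nonempty) (hprime : ∀ p ∈ Sigma, p.Prime) (j : Fin 4) {n : ℕ} (hn : 0 < n) :
    M.ι (SemidirectProduct.inl (c j ^ n : PuncturedSurfaceGroup 0 4)) ∉ M.baseSec j := by
  intro h
  have hG : M.ι (SemidirectProduct.inl (c j ^ n : PuncturedSurfaceGroup 0 4)) ∈ M.PiG :=
    Subgroup.map_subtype_le _ (M.inl_pow_mem_cuspGp_map j n)
  have h2 : M.ι (SemidirectProduct.inl (c j ^ n : PuncturedSurfaceGroup 0 4)) ∈ M.baseSec j ⊓ M.PiG := ⟨h, hG⟩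
  rw [M.baseSec_inf_PiG hne hprime, Subgroup.mem_bot] at h2
  exact M.inl_pow_ne_one hne hprime j hn h2

/-- **A slope section of positive slope is not contained in the inertia section `I_v`** (`S_{j,n} ⊆ I_v` would put
`ι(c_j)^n = (ι(c_j)^n s_j) s_j⁻¹` in `I_v`). [cite: MochizukiAbsTopII2013, Prop 1.3 (x) p.12] -/
theorem not_cuspSection_le_baseSec (hne : Sigma.Nonempty) (hprime : ∀ p ∈ Sigma, p.Prime) (j : Fin 4) {n : ℕ} (hn : 0 < n) : ¬ M.cuspSection j n ≤ M.baseSec j := by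
  intro h
  have hg : M.cuspGen j n ∈ M.baseSec j := h (M.cuspGen_mem_cuspSection j n)
  rw [cuspGen_eq] at hg
  exact M.inl_pow_notMem_baseSec hne hprime j hn ((Subgroup.mul_mem_cancel_right _ (M.baseGen_mem_baseSec j)).mp hg)

/-! ### The engine: a conjugate of `S_{j,n}` inside a conjugate of `D` forces `S_{j,n} ⊆ I_v` -/

/-- `S_{j,n} ⊆ Π_{c_j} · I_v = D_{c_j}` (inside `P`). [cite: MochizukiAbsTopII2013, Prop 1.3 (x) p.12] -/
theorem cuspSection_le_cuspD (hne : Sigma.Nonempty) (hprime : ∀ p ∈ Sigma, p.Prime) (j : Fin 4) (n : ℕ) :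
    M.cuspSection j n ≤ (M.cuspGp j).map M.PiG.subtype ⊔ M.baseSec j :=
  (M.cuspSection_le_DvCusp hne hprime j n).trans (M.DvCusp_eq_sup_baseSec hne hprime j).le

/-- **Engine.** If `D ⊆ P` satisfies `(Π_{c_j}·I_v) ∩ γ D γ⁻¹ ⊆ I_v` for all `γ ∈ Π_𝔾`, then for `n ≥ 1` no conjugate
`δ S_{j,n} δ⁻¹` (`δ ∈ P`) lies in a `Π_𝔾`-conjugate of `D`: writing `δ = γ₁ s` (`γ₁ ∈ Π_𝔾`, `s ∈ I_v`), a containment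
gives `s S_{j,n} s⁻¹ ⊆ (Π_{c_j}·I_v) ∩ γ' D γ'⁻¹ ⊆ I_v`, hence `S_{j,n} ⊆ I_v`.
[cite: MochizukiAbsTopII2013, Prop 1.3 (x) p.12] -/
theorem not_conj_cuspSection_le_conj (hne : Sigma.Nonempty) (hprime : ∀ p ∈ Sigma, p.Prime) (j : Fin 4) {n : ℕ} (hn : 0 < n) (δ : M.P) {D : Subgroup M.P}
    (hD : ∀ γ ∈ M.PiG, ((M.cuspGp j).map M.PiG.subtype ⊔ M.baseSec j) ⊓ MulAut.conj γ • D ≤ M.baseSec j)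
    {γ : M.P} (hγ : γ ∈ M.PiG) : ¬ MulAut.conj δ • M.cuspSection j n ≤ MulAut.conj γ • D := by
  intro h
  obtain ⟨γ₁, hγ₁, s, hs, rfl⟩ := M.exists_eq_mul_of_sup_eq_top (M.baseSec_sup_PiG j) δ
  -- `s S s⁻¹ ⊆ (γ₁⁻¹ γ) D (γ₁⁻¹ γ)⁻¹`
  have h1 : MulAut.conj s • M.cuspSection j n ≤ MulAut.conj (γ₁⁻¹ * γ) • D := by
    rw [map_mul, mul_smul, Subgroup.pointwise_smul_subset_iff, ← mul_smul, ← map_inv, ← map_mul] at h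
    exact h
  -- `s S s⁻¹ ⊆ s (Π_{c_j}·I_v) s⁻¹ = Π_{c_j}·I_v`
  have h2 : MulAut.conj s • M.cuspSection j n ≤ (M.cuspGp j).map M.PiG.subtype ⊔ M.baseSec j := by
    have h' := Subgroup.pointwise_smul_le_pointwise_smul_iff (a := MulAut.conj s).mpr (M.cuspSection_le_cuspD hne hprime j n)
    rwa [Subgroup.conj_smul_eq_self_of_mem (Subgroup.mem_sup_right hs)] at h'
  have h3 : MulAut.conj s • M.cuspSection j n ≤ M.baseSec j :=
    le_trans (le_inf h2 h1) (hD _ (M.PiG.mul_mem (M.PiG.inv_mem hγ₁) hγ))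
  have h4 : M.cuspSection j n ≤ M.baseSec j := by
    rw [Subgroup.pointwise_smul_subset_iff, ← map_inv, Subgroup.conj_smul_eq_self_of_mem (Subgroup.inv_mem _ hs)] at h3
    exact h3
  exact M.not_cuspSection_le_baseSec hne hprime j hn h4

/-- **No conjugate of `S_{j,n}` (`n ≥ 1`) lies in a `Π_𝔾`-conjugate of `D_e = Π_e·T`.** [cite: MochizukiAbsTopII2013, Prop 1.3 (x) p.12] -/
theorem not_conj_cuspSection_le_conj_nodeD (hne : Sigma.Nonempty) (hprime : ∀ p ∈ Sigma, p.Prime) (j : Fin 4) {n : ℕ} (hn : 0 < n) (δ : M.P) {γ : M.P} (hγ : γ ∈ M.PiG) :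
    ¬ MulAut.conj δ • M.cuspSection j n ≤ MulAut.conj γ • ((M.nodeGp).map M.PiG.subtype ⊔ M.T) :=
  M.not_conj_cuspSection_le_conj hne hprime j hn δ (fun _ hγ' => M.cuspD_inf_conj_nodeD_le_baseSec hne hprime j hγ') hγ

/-- **No conjugate of `S_{j,n}` (`n ≥ 1`) lies in a `Π_𝔾`-conjugate of `D_{c_{j'}} = Π_{c_{j'}}·I_{v'}`, `j' ≠ j`.**
[cite: MochizukiAbsTopII2013, Prop 1.3 (x) p.12] -/
theorem not_conj_cuspSection_le_conj_cuspD (hne : Sigma.Nonempty) (hprime : ∀ p ∈ Sigma, p.Prime) (j : Fin 4) {n : ℕ} (hn : 0 < n) (δ : M.P) {j' : Fin 4} (hjj' : j' ≠ j)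
    {γ : M.P} (hγ : γ ∈ M.PiG) :
    ¬ MulAut.conj δ • M.cuspSection j n ≤ MulAut.conj γ • ((M.cuspGp j').map M.PiG.subtype ⊔ M.baseSec j') :=
  M.not_conj_cuspSection_le_conj hne hprime j hn δ (fun _ hγ' => M.cuspD_inf_conj_cuspD_le_baseSec hne hprime j j' hjj' hγ') hγ

/-- `I_v ⊆ Π_e·T = D_e` for BOTH vertices (the node abuts to both; `Π_e·T = Π_e·U`).
[cite: MochizukiAbsTopII2013, Prop 1.3 (ii) p.11] -/
theorem vertSec_le_nodeD (v : Fin 2) : M.vertSec v ≤ (M.nodeGp).map M.PiG.subtype ⊔ M.T := by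
  have hv : v = 0 ∨ v = 1 := by fin_cases v <;> simp
  rcases hv with rfl | rfl
  · exact le_sup_right
  · rw [vertSec_one, ← T_sup_U_eq_WT]; exact le_sup_right

/-- A `P`-conjugate of a subgroup of `D_e = Π_e·T` lies in a `Π_𝔾`-conjugate of `D_e` (`P = Π_𝔾·T`, `T ⊆ D_e`).
[cite: MochizukiAbsTopII2013, Def 1.2 (ii) p.10] -/
theorem exists_conj_le_conj_nodeD {H : Subgroup M.P} (hH : H ≤ (M.nodeGp).map M.PiG.subtype ⊔ M.T) (g : M.P) :
    ∃ γ : M.P, γ ∈ M.PiG ∧ MulAut.conj g • H ≤ MulAut.conj γ • ((M.nodeGp).map M.PiG.subtype ⊔ M.T) := by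
  obtain ⟨γ, hγ, t, ht, rfl⟩ := M.exists_eq_mul_of_sup_eq_top M.T_sup_PiG g
  refine ⟨γ, hγ, ?_⟩
  rw [map_mul, mul_smul, Subgroup.pointwise_smul_le_pointwise_smul_iff]
  calc MulAut.conj t • H ≤ MulAut.conj t • ((M.nodeGp).map M.PiG.subtype ⊔ M.T) :=
        Subgroup.pointwise_smul_le_pointwise_smul_iff.mpr hH
    _ = (M.nodeGp).map M.PiG.subtype ⊔ M.T := Subgroup.conj_smul_eq_self_of_mem (Subgroup.mem_sup_right ht)

/-- `Π_𝔾 ≠ P` (`T ≠ 1` meets `Π_𝔾` trivially). [cite: MochizukiAbsTopII2013, Prop 1.3 (iii) p.11] -/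
theorem PiG_ne_top (hne : Sigma.Nonempty) (hprime : ∀ p ∈ Sigma, p.Prime) : M.PiG ≠ ⊤ := fun h =>
  M.T_ne_bot hne hprime (by rw [← M.T_inf_PiG, h, inf_top_eq])

end Literature.AnabelianGeometry.AbsoluteAnabelian.AbsTopII.TwoTripodNodal.Model

end
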